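import Literature.Analysis.Calculus.BCHProductLowOrder
import Literature.MathematicalPhysics.QuantumFieldTheory.Balaban1983to89.BlockAveragingExpMeanLog
import HarnessLib

/-!
# S2β · `hFlat` road, brick (iii-a) of UV3-NODE §57.8 — «THE PRINTED AVERAGE (0.4) IS THE GEOMETRIC MEAN OF THE MEMBER TRANSPORTS UP TO
# A THIRD-ORDER TERM LINEAR IN THE MEMBERS»: `‖log(exp(mean_i a_i)·e^Y) − mean_i log(exp(a_i)·e^Y)‖ ≤ 2K·mean_i‖a_i‖`,
# `K = 12000(θ+σ)³ + ⅓σ(θ+σ)` (`‖a_i‖ ≤ θ`, `‖Y‖ ≤ σ`, `θ + σ ≤ 3∕20`), and its `SU(N)` form for `ESU W · S`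

Cell `ym3-torus` (rung R3 = continuum `SU(2)` Yang–Mills on the three-torus — NOT d = 4, NOT infinite volume, NOT a mass gap, NOT Clay).
Width seat «width 8» `ym3-torus-px8` (gen 21), FREE px helper on crux `stmt-QuantumFields-20520` (`Theses.UnitScaleTilt.FluctuationComparisonRegPrIntL`),
count-neutral, DEFINITION-FREE.

WHY (UV3-NODE §57.8 (C)(1)).  In the nonabelian KEY LEMMA of the telescoped `hFlat` road the averaged bond variable `ū(b) = E(W)·S` (lit (0.4): `E(W) =
exp(mean_i log W_i)`, `S` the straight transport) must be compared with the member transports `P_i = W_i·S`: replacing the average by a member INSIDE a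
logarithm of a product costs only terms that are (small) × (the ℓ¹-MEAN of the member sizes `‖log W_i‖`) — chargeable to the action — never a bare power of the
transport size `σ`.  Mechanism: `log(e^X e^Y) = X + Y + ½[X,Y] + T(X,Y)` with a tail `T` LINEAR IN `‖X‖` (lit ✓`BCH.norm_logOnePlus_sub_bch3_le_mul`: the
Schwarz-lemma form of the two-factor BCH remainder, + the explicit cubic terms of `bch3`), and `X ↦ X + Y + ½[X,Y]` is AFFINE, so means pass through it exactly.

* §1 `norm_bch3_sub_quad_le` (`‖bch3 X Y − (X + Y + ½[X,Y])‖ ≤ ⅓‖X‖‖Y‖(‖X‖+‖Y‖)`), ★ `norm_mlog_exp_mul_exp_sub_quad_le`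
  (`‖log(e^Xe^Y) − (X + Y + ½[X,Y])‖ ≤ ‖X‖·(12000(‖X‖+‖Y‖)³ + ⅓‖Y‖(‖X‖+‖Y‖))` on `‖X‖+‖Y‖ ≤ 3∕20`).
* §2 ★★ `norm_mlog_expMean_mul_sub_mean_le` — THE MEMBER-MEAN LEMMA with convex weights `w_i ≥ 0`, `Σ w_i = 1`:
  `‖log(exp(Σ_i w_i•a_i)·e^Y) − Σ_i w_i•log(exp(a_i)·e^Y)‖ ≤ 2·(12000(θ+σ)³ + ⅓σ(θ+σ))·Σ_i w_i‖a_i‖`.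
* §3 `SU(N)` forms (operator norm; lit `ExpMeanLog`: `ESU W = exp(|I|⁻¹Σ log W_i)` on the guard, `exp(log X) = X`): ★★ `norm_mlog_ESU_mul_sub_mean_le` — for
  `dist1 (W i) ≤ ρ < δ_N`, `ρ ≤ 1∕20`, `dist1 S ≤ ρ′ ≤ 1∕20`:
  `‖log((ESU W : M_N)·S) − |I|⁻¹Σ_i log((W i : M_N)·S)‖ ≤ 2·(12000(θ+σ)³ + ⅓σ(θ+σ))·|I|⁻¹Σ_i ‖log (W i)‖`, `θ = ρ∕(1−ρ)`, `σ = ρ′∕(1−ρ′)`.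

HONEST SCOPE.  Banach-algebra bookkeeping over the tree's landed BCH remainder and `exp[mean log]` letters; nothing of Bałaban's analysis; the coupling step
(§57.8 (C)(2)), the nonabelian KEY LEMMA, the recursion, `hFlat`, TUBE-REG∘, GAP♯∘ (`stub_uniformFibreGapOrbit`), S2β, crux 20520 and `YM3TorusSU2` are NOT proved;
no registered stub is closed; the Yang–Mills mass gap is NOT proved.
References: T. Bałaban, CMP **109** (1987) 249–301 [Balaban1987RG1] ((0.4)–(0.8) p.253); W. Rossmann, *Lie Groups* (OUP 2002) §1.3 Thm 1 [Rossmann2002].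
-/

set_option autoImplicit false

noncomputable section

open NormedSpace
open scoped BigOperators Matrix.Norms.L2Operator

namespace Summit.QuantumFields.YangMills.Theorems.FluctuationComparisonRegPrIntLS2BetaEmlMemberTransportMean

open Literature.Analysis.Calculus.BCH (bch3 norm_logOnePlus_sub_bch3_le_mul)
open Literature.MathematicalPhysics.QuantumFieldTheory.Balaban1983to89
open Literature.MathematicalPhysics.QuantumFieldTheory.Balaban1983to89.MatrixLog (mlog mlog_def exp_mlog norm_mlog_le_div)
open Literature.MathematicalPhysics.QuantumFieldTheory.Balaban1983to89.ExpMeanLog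
  (eml eml_eq_exp ESU coe_ESU_of_small deltaSU lt_third_of_lt_deltaSU)

/-! ## §1 The two-factor logarithm up to second order, with a tail LINEAR in the first factor -/

section Banach

variable {𝔸 : Type*} [NormedRing 𝔸] [NormedAlgebra ℂ 𝔸] [CompleteSpace 𝔸]

omit [CompleteSpace 𝔸] in
/-- The cubic terms of `bch3`: `‖bch3 X Y − (X + Y + ½[X,Y])‖ ≤ ⅓·‖X‖·‖Y‖·(‖X‖ + ‖Y‖)` (`[X,[X,Y]]` and `[Y,[Y,X]]` each `≤ 4‖·‖²‖·‖`).
[cite: Rossmann2002, §1.3 Problem 2] -/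
theorem norm_bch3_sub_quad_le (X Y : 𝔸) :
    ‖bch3 X Y - (X + Y + (2 : ℂ)⁻¹ • (X * Y - Y * X))‖ ≤ 1 / 3 * ‖X‖ * ‖Y‖ * (‖X‖ + ‖Y‖) := by
  have e : bch3 X Y - (X + Y + (2 : ℂ)⁻¹ • (X * Y - Y * X)) =
      (12 : ℂ)⁻¹ • ((X * (X * Y - Y * X) - (X * Y - Y * X) * X) + (Y * (Y * X - X * Y) - (Y * X - X * Y) * Y)) := by
    unfold bch3; abel
  rw [e, norm_smul, norm_inv, RCLike.norm_ofNat]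
  have hc : ‖X * Y - Y * X‖ ≤ 2 * ‖X‖ * ‖Y‖ := by
    refine (norm_sub_le _ _).trans ?_
    have h1 := norm_mul_le X Y; have h2 := norm_mul_le Y X; linarith
  have hc' : ‖Y * X - X * Y‖ ≤ 2 * ‖X‖ * ‖Y‖ := by
    refine (norm_sub_le _ _).trans ?_
    have h1 := norm_mul_le Y X; have h2 := norm_mul_le X Y; linarith
  have h1 : ‖X * (X * Y - Y * X) - (X * Y - Y * X) * X‖ ≤ 4 * ‖X‖ ^ 2 * ‖Y‖ := by
    refine (norm_sub_le _ _).trans ?_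
    have := norm_mul_le X (X * Y - Y * X); have := norm_mul_le (X * Y - Y * X) X
    nlinarith [norm_nonneg X, norm_nonneg Y, norm_nonneg (X * Y - Y * X)]
  have h2 : ‖Y * (Y * X - X * Y) - (Y * X - X * Y) * Y‖ ≤ 4 * ‖Y‖ ^ 2 * ‖X‖ := by
    refine (norm_sub_le _ _).trans ?_
    have := norm_mul_le Y (Y * X - X * Y); have := norm_mul_le (Y * X - X * Y) Y
    nlinarith [norm_nonneg X, norm_nonneg Y, norm_nonneg (Y * X - X * Y)]
  have h := (norm_add_le _ _).trans (add_le_add h1 h2)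
  have hX := norm_nonneg X; have hY := norm_nonneg Y
  nlinarith [h, mul_nonneg hX hY]

/-- ★ **`log(e^X e^Y) = X + Y + ½[X,Y]` UP TO A TERM LINEAR IN `‖X‖`**: for `‖X‖ + ‖Y‖ ≤ 3∕20`,
`‖log(e^Xe^Y) − (X + Y + ½[X,Y])‖ ≤ ‖X‖·(12000·(‖X‖+‖Y‖)³ + ⅓·‖Y‖·(‖X‖+‖Y‖))` (lit ✓`norm_logOnePlus_sub_bch3_le_mul` — the Schwarz-lemma
tail `12000‖X‖(‖X‖+‖Y‖)³` — plus §1's cubic terms; `log` = the series logarithm `mlog`). [cite: Rossmann2002, §1.3 Theorem 1] -/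
theorem norm_mlog_exp_mul_exp_sub_quad_le (X Y : 𝔸) (h : ‖X‖ + ‖Y‖ ≤ 3 / 20) :
    ‖mlog (exp X * exp Y) - (X + Y + (2 : ℂ)⁻¹ • (X * Y - Y * X))‖ ≤ ‖X‖ * (12000 * (‖X‖ + ‖Y‖) ^ 3 + 1 / 3 * ‖Y‖ * (‖X‖ + ‖Y‖)) := by
  have h1 : ‖mlog (exp X * exp Y) - bch3 X Y‖ ≤ 12000 * ‖X‖ * (‖X‖ + ‖Y‖) ^ 3 := by
    rw [mlog_def]; exact norm_logOnePlus_sub_bch3_le_mul X Y h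
  have h2 := norm_bch3_sub_quad_le X Y
  calc ‖mlog (exp X * exp Y) - (X + Y + (2 : ℂ)⁻¹ • (X * Y - Y * X))‖
      ≤ ‖mlog (exp X * exp Y) - bch3 X Y‖ + ‖bch3 X Y - (X + Y + (2 : ℂ)⁻¹ • (X * Y - Y * X))‖ := norm_sub_le_norm_sub_add_norm_sub _ _ _
    _ ≤ 12000 * ‖X‖ * (‖X‖ + ‖Y‖) ^ 3 + 1 / 3 * ‖X‖ * ‖Y‖ * (‖X‖ + ‖Y‖) := add_le_add h1 h2
    _ = ‖X‖ * (12000 * (‖X‖ + ‖Y‖) ^ 3 + 1 / 3 * ‖Y‖ * (‖X‖ + ‖Y‖)) := by ring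

/-! ## §2 The member-mean lemma -/

/-- ★★ **THE MEMBER-MEAN LEMMA**: convex weights `w i ≥ 0`, `Σ_{i∈s} w i = 1`, members `‖a i‖ ≤ θ`, `‖Y‖ ≤ σ`, `θ + σ ≤ 3∕20`:
`‖log(exp(Σ_i w i•a i)·e^Y) − Σ_i w i•log(exp(a i)·e^Y)‖ ≤ 2·(12000(θ+σ)³ + ⅓σ(θ+σ))·Σ_i w i·‖a i‖` — the affine part `X + Y + ½[X,Y]` passes
through the mean EXACTLY, so only §1's tails remain, each LINEAR in its member (`‖Σ w•a‖ ≤ Σ w‖a‖`): the error is (small) × (the weighted ℓ¹-size of the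
members), never a bare power of `σ`. [cite: Balaban1987RG1, (0.4)-(0.8) p.253] -/
theorem norm_mlog_expMean_mul_sub_mean_le {ι : Type*} (s : Finset ι) {w : ι → ℝ} (hw0 : ∀ i ∈ s, 0 ≤ w i)
    (hw1 : ∑ i ∈ s, w i = 1) {a : ι → 𝔸} {Y : 𝔸} {θ σ : ℝ} (ha : ∀ i ∈ s, ‖a i‖ ≤ θ) (hY : ‖Y‖ ≤ σ) (hθσ : θ + σ ≤ 3 / 20) :
    ‖mlog (exp (∑ i ∈ s, (w i : ℂ) • a i) * exp Y) - ∑ i ∈ s, (w i : ℂ) • mlog (exp (a i) * exp Y)‖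
      ≤ 2 * (12000 * (θ + σ) ^ 3 + 1 / 3 * σ * (θ + σ)) * ∑ i ∈ s, w i * ‖a i‖ := by
  set abar := ∑ i ∈ s, (w i : ℂ) • a i with habar
  set K : ℝ := 12000 * (θ + σ) ^ 3 + 1 / 3 * σ * (θ + σ) with hK
  -- sizes
  have hσ0 : 0 ≤ σ := (norm_nonneg Y).trans hY
  have hwn : ∀ i ∈ s, ‖(w i : ℂ)‖ = w i := fun i hi => by rw [Complex.norm_real, Real.norm_eq_abs, abs_of_nonneg (hw0 i hi)]
  have hmean : ‖abar‖ ≤ ∑ i ∈ s, w i * ‖a i‖ := by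
    refine (norm_sum_le _ _).trans (le_of_eq (Finset.sum_congr rfl fun i hi => ?_))
    rw [norm_smul, hwn i hi]
  have hS0 : 0 ≤ ∑ i ∈ s, w i * ‖a i‖ := Finset.sum_nonneg fun i hi => mul_nonneg (hw0 i hi) (norm_nonneg _)
  have hSθ : ∑ i ∈ s, w i * ‖a i‖ ≤ θ := by
    calc ∑ i ∈ s, w i * ‖a i‖ ≤ ∑ i ∈ s, w i * θ := Finset.sum_le_sum fun i hi => mul_le_mul_of_nonneg_left (ha i hi) (hw0 i hi)
      _ = θ := by rw [← Finset.sum_mul, hw1, one_mul]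
  have hθ0 : 0 ≤ θ := hS0.trans hSθ
  have habarθ : ‖abar‖ ≤ θ := hmean.trans hSθ
  have hK0 : 0 ≤ K := by rw [hK]; positivity
  -- the tail at X is ≤ ‖X‖·K whenever ‖X‖ ≤ θ
  have htail : ∀ X : 𝔸, ‖X‖ ≤ θ → ‖mlog (exp X * exp Y) - (X + Y + (2 : ℂ)⁻¹ • (X * Y - Y * X))‖ ≤ ‖X‖ * K := by
    intro X hX
    have hXY : ‖X‖ + ‖Y‖ ≤ 3 / 20 := by linarith
    refine (norm_mlog_exp_mul_exp_sub_quad_le X Y hXY).trans (mul_le_mul_of_nonneg_left ?_ (norm_nonneg X))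
    rw [hK]
    have h1 : (‖X‖ + ‖Y‖) ^ 3 ≤ (θ + σ) ^ 3 := pow_le_pow_left₀ (by positivity) (by linarith) 3
    have h2 : 1 / 3 * ‖Y‖ * (‖X‖ + ‖Y‖) ≤ 1 / 3 * σ * (θ + σ) := by
      have := norm_nonneg X; have := norm_nonneg Y; nlinarith
    linarith
  -- the affine part passes through the mean exactly
  have haff : ∑ i ∈ s, (w i : ℂ) • (a i + Y + (2 : ℂ)⁻¹ • (a i * Y - Y * a i)) = abar + Y + (2 : ℂ)⁻¹ • (abar * Y - Y * abar) := by
    have hw1c : ∑ i ∈ s, (w i : ℂ) = 1 := by rw [← Complex.ofReal_sum, hw1, Complex.ofReal_one]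
    have e1 : ∑ i ∈ s, (w i : ℂ) • Y = Y := by rw [← Finset.sum_smul, hw1c, one_smul]
    have e2 : ∑ i ∈ s, (w i : ℂ) • ((2 : ℂ)⁻¹ • (a i * Y - Y * a i)) = (2 : ℂ)⁻¹ • (abar * Y - Y * abar) := by
      have e3 : ∑ i ∈ s, (w i : ℂ) • ((2 : ℂ)⁻¹ • (a i * Y - Y * a i)) = (2 : ℂ)⁻¹ • ∑ i ∈ s, (w i : ℂ) • (a i * Y - Y * a i) := by
        rw [Finset.smul_sum]
        exact Finset.sum_congr rfl fun i _ => smul_comm _ _ _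
      rw [e3, habar, Finset.sum_mul, Finset.mul_sum, ← Finset.sum_sub_distrib]
      congr 1
      refine Finset.sum_congr rfl fun i _ => ?_
      rw [smul_sub, smul_mul_assoc, mul_smul_comm]
    simp only [smul_add, Finset.sum_add_distrib]
    rw [e1, e2]
  -- split the difference into the two tails
  have hdecomp : mlog (exp abar * exp Y) - ∑ i ∈ s, (w i : ℂ) • mlog (exp (a i) * exp Y) =
      (mlog (exp abar * exp Y) - (abar + Y + (2 : ℂ)⁻¹ • (abar * Y - Y * abar))) -
        ∑ i ∈ s, (w i : ℂ) • (mlog (exp (a i) * exp Y) - (a i + Y + (2 : ℂ)⁻¹ • (a i * Y - Y * a i))) := by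
    rw [← haff]; simp only [smul_sub, Finset.sum_sub_distrib]; abel
  rw [hdecomp]
  calc ‖(mlog (exp abar * exp Y) - (abar + Y + (2 : ℂ)⁻¹ • (abar * Y - Y * abar))) -
        ∑ i ∈ s, (w i : ℂ) • (mlog (exp (a i) * exp Y) - (a i + Y + (2 : ℂ)⁻¹ • (a i * Y - Y * a i)))‖
      ≤ ‖abar‖ * K + ∑ i ∈ s, w i * (‖a i‖ * K) := by
        refine (norm_sub_le _ _).trans (add_le_add (htail abar habarθ) ((norm_sum_le _ _).trans (Finset.sum_le_sum fun i hi => ?_)))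
        rw [norm_smul, hwn i hi]
        exact mul_le_mul_of_nonneg_left (htail (a i) (ha i hi)) (hw0 i hi)
    _ ≤ (∑ i ∈ s, w i * ‖a i‖) * K + (∑ i ∈ s, w i * ‖a i‖) * K := by
        refine add_le_add (mul_le_mul_of_nonneg_right hmean hK0) (le_of_eq ?_)
        rw [Finset.sum_mul]; exact Finset.sum_congr rfl fun i _ => by ring
    _ = 2 * (12000 * (θ + σ) ^ 3 + 1 / 3 * σ * (θ + σ)) * ∑ i ∈ s, w i * ‖a i‖ := by rw [hK]; ring

end Banach

/-! ## §3 The `SU(N)` form: `log(ESU W · S)` vs the mean of `log(W_i · S)` -/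

section SUN

variable {n : Type*} [Fintype n] [DecidableEq n] [Nonempty n]
variable {ι : Type*} [Fintype ι] [Nonempty ι]

/-- ★★ **THE MEMBER-MEAN LEMMA FOR THE PRINTED `SU(N)` AVERAGE**: for a family `W : ι → SU(N)` with `dist1 (W i) ≤ ρ`, `ρ < δ_N`, `ρ ≤ 1∕20`, and
`S ∈ SU(N)` with `dist1 S ≤ ρ′ ≤ 1∕20` (so `θ := ρ∕(1−ρ)`, `σ := ρ′∕(1−ρ′)` bound the logarithms, lit (26), and `θ + σ ≤ 3∕20`):
`‖log((ESU W : M_N)·S) − |I|⁻¹Σ_i log((W i : M_N)·S)‖ ≤ 2·(12000(θ+σ)³ + ⅓σ(θ+σ))·|I|⁻¹Σ_i‖log (W i)‖` — replacing the average by its members inside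
the logarithm of the transport `ū = E(W)·S` costs (small) × (the ℓ¹-mean of the member logarithms). [cite: Balaban1987RG1, (0.4)-(0.8) p.253] -/
theorem norm_mlog_ESU_mul_sub_mean_le (W : ι → Matrix.specialUnitaryGroup n ℂ) (S : Matrix.specialUnitaryGroup n ℂ)
    {ρ ρ' : ℝ} (hρ : ρ < deltaSU n) (hρ20 : ρ ≤ 1 / 20) (hρ'20 : ρ' ≤ 1 / 20)
    (hW : ∀ i, dist1 (W i) ≤ ρ) (hS : dist1 S ≤ ρ') :
    ‖mlog (((ESU W : Matrix.specialUnitaryGroup n ℂ) : Matrix n n ℂ) * (S : Matrix n n ℂ)) -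
        ((Fintype.card ι : ℂ))⁻¹ • ∑ i, mlog ((W i : Matrix n n ℂ) * (S : Matrix n n ℂ))‖
      ≤ 2 * (12000 * (ρ / (1 - ρ) + ρ' / (1 - ρ')) ^ 3 + 1 / 3 * (ρ' / (1 - ρ')) * (ρ / (1 - ρ) + ρ' / (1 - ρ'))) *
          (((Fintype.card ι : ℝ))⁻¹ * ∑ i, ‖mlog (W i : Matrix n n ℂ)‖) := by
  have hρ0 : 0 ≤ ρ := (GaugeGroup.dist1_nonneg _).trans (hW (Classical.arbitrary ι))
  have hρ'0 : 0 ≤ ρ' := (GaugeGroup.dist1_nonneg _).trans hS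
  have hWn : ∀ i, ‖(W i : Matrix n n ℂ) - 1‖ ≤ ρ := fun i => hW i
  have hSn : ‖(S : Matrix n n ℂ) - 1‖ ≤ ρ' := hS
  -- logarithms and their sizes
  set a : ι → Matrix n n ℂ := fun i => mlog (W i : Matrix n n ℂ) with ha
  set Y : Matrix n n ℂ := mlog (S : Matrix n n ℂ) with hY
  have hθ : ∀ i, ‖a i‖ ≤ ρ / (1 - ρ) := fun i => by
    have h1 : ‖(W i : Matrix n n ℂ) - 1‖ < 1 := (hWn i).trans_lt (by linarith)
    refine (norm_mlog_le_div h1).trans ?_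
    rw [div_le_div_iff₀ (by linarith) (by linarith)]; nlinarith [hWn i, norm_nonneg ((W i : Matrix n n ℂ) - 1)]
  have hσ : ‖Y‖ ≤ ρ' / (1 - ρ') := by
    have h1 : ‖(S : Matrix n n ℂ) - 1‖ < 1 := hSn.trans_lt (by linarith)
    refine (norm_mlog_le_div h1).trans ?_
    rw [div_le_div_iff₀ (by linarith) (by linarith)]; nlinarith [hSn, norm_nonneg ((S : Matrix n n ℂ) - 1)]
  have hθσ : ρ / (1 - ρ) + ρ' / (1 - ρ') ≤ 3 / 20 := by
    have h1 : ρ / (1 - ρ) ≤ 1 / 19 := by rw [div_le_div_iff₀ (by linarith) (by norm_num)]; linarith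
    have h2 : ρ' / (1 - ρ') ≤ 1 / 19 := by rw [div_le_div_iff₀ (by linarith) (by norm_num)]; linarith
    linarith
  -- exp of the logs
  have hexpW : ∀ i, exp (a i) = (W i : Matrix n n ℂ) := fun i => exp_mlog ((hWn i).trans_lt (by linarith))
  have hexpS : exp Y = (S : Matrix n n ℂ) := exp_mlog (hSn.trans_lt (by linarith))
  have hguard : ∀ i, ‖(W i : Matrix n n ℂ) - 1‖ < deltaSU n := fun i => (hWn i).trans_lt hρ
  have hESU : ((ESU W : Matrix.specialUnitaryGroup n ℂ) : Matrix n n ℂ) = exp (((Fintype.card ι : ℂ))⁻¹ • ∑ i, a i) := by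
    rw [coe_ESU_of_small hguard, eml_eq_exp]
  -- uniform weights
  have hc : (0 : ℝ) < Fintype.card ι := Nat.cast_pos.mpr Fintype.card_pos
  have hmain := norm_mlog_expMean_mul_sub_mean_le (𝔸 := Matrix n n ℂ) Finset.univ (w := fun _ : ι => ((Fintype.card ι : ℝ))⁻¹)
    (fun _ _ => inv_nonneg.mpr hc.le) (by rw [Finset.sum_const, Finset.card_univ, nsmul_eq_mul, mul_inv_cancel₀ hc.ne'])
    (a := a) (Y := Y) (fun i _ => hθ i) hσ hθσ
  have hcoe : ((((Fintype.card ι : ℝ))⁻¹ : ℝ) : ℂ) = ((Fintype.card ι : ℂ))⁻¹ := by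
    rw [Complex.ofReal_inv, Complex.ofReal_natCast]
  simp only [hcoe] at hmain
  rw [← Finset.smul_sum, ← Finset.smul_sum, ← Finset.mul_sum] at hmain
  simp only [hexpW, hexpS] at hmain
  rw [hESU]
  exact hmain

end SUN

end Summit.QuantumFields.YangMills.Theorems.FluctuationComparisonRegPrIntLS2BetaEmlMemberTransportMean

end
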